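import Summits.HubbardSuperconductivity.HubbardSuperconductivity.Theorems.LevyLogBootstrapDressHalfFilledPlaquetteSectorGaps
import Summits.HubbardSuperconductivity.HubbardSuperconductivity.Theorems.CooperPairDMottWalkCooperPairDMottPairTrialCeilingGCDefect
import HarnessLib

/-!
# Route `LevyLogBootstrap`, crux `DressHalfFilled` (stmt-HubbardSuperconductivity-8148), stub 2
# `stub_plaquetteDictionary`: the local band gap of one plaquette (defect form)

Support file (plaquette level of the exhaustion clause (c) of `PlaquetteDictionary`). With `h = plaquetteHamiltonian U`,
band states `s₀ = |0h⟩`, `s₁ = |2h⟩` (`plaquetteStates U`), energies `e₀ = plaquetteEnergy U 0`, `e₂ = plaquetteEnergy U 2`,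
slope `μ = (e₀ − e₂)/2` and intercept `α = 2e₂ − e₀` of the chord `ℓ(n) = α + μ n` through `(2, e₂)`, `(4, e₀)`, the
plaquette data (W3)–(W5) give the **local band gap in defect form** (`plaquette_bandGap`): for some `γ > 0` and ALL `v`,

  `γ (‖v‖² − Re⟨v, (|s₀⟩⟨s₀| + |s₁⟩⟨s₁|) v⟩) ≤ Re⟨v, (h − μ N) v⟩ − α ‖v‖²`,

i.e. `h − ℓ(N) ≥ γ (1 − P_band)` as forms. Proof: the sector-wise margins of
`LevyLogBootstrapDressHalfFilledPlaquetteSectorGaps` give `(α + γ)‖v‖² ≤ Re⟨v, (h − μN) v⟩` for `v ⊥ s₀, s₁`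
(decompose `v` into coordinate sectors, `form_eq_sum_sectorProj`), `h − μN` acts as `α` on the band, and the
tree's `re_form_defect_le_of_gap` converts the gap into the defect form. This is the inequality transported to the
torus by `re_form_defect_jwEmbed` in the exhaustion step.

References: W.-F. Tsai, S. A. Kivelson, PRB 73 (2006) 214510, App. A; H. Tasaki (2020) §2.1, App. A.2. All statements
are [folklore]; no definition is introduced.
-/

set_option linter.dupNamespace false

noncomputable section

namespace Summit.HubbardSuperconductivity.HubbardSuperconductivity.Theorems.LevyLogBootstrap

open Matrix Finset Literature.MathematicalPhysics.QuantumLattice Literature.Probability.LatticeModels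
open Summit.HubbardSuperconductivity.HubbardSuperconductivity.Theorems.CooperPairDMottWalk
open scoped ComplexOrder

/-- The band states as eigenvectors of `h` with the energies `e₀`, `e₂` (numerals normalised). [folklore] -/
theorem plaquetteHamiltonian_mulVec_plaquetteStates₀₁ (U : ℝ) :
    plaquetteHamiltonian U *ᵥ plaquetteStates U 0 = ((plaquetteEnergy U 0 : ℝ) : ℂ) • plaquetteStates U 0 ∧
      plaquetteHamiltonian U *ᵥ plaquetteStates U 1 = ((plaquetteEnergy U 2 : ℝ) : ℂ) • plaquetteStates U 1 := by
  constructor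
  · simpa using plaquetteHamiltonian_mulVec_plaquetteStates U 0
  · simpa using plaquetteHamiltonian_mulVec_plaquetteStates U 1

/-- The band states as eigenvectors of `N` with eigenvalues `4`, `2` (numerals normalised). [folklore] -/
theorem totalNumber_mulVec_plaquetteStates₀₁ (U : ℝ) :
    (totalNumber : Matrix (Finset (Orb PlaquetteSite)) (Finset (Orb PlaquetteSite)) ℂ) *ᵥ plaquetteStates U 0 =
        (4 : ℂ) • plaquetteStates U 0 ∧
      (totalNumber : Matrix (Finset (Orb PlaquetteSite)) (Finset (Orb PlaquetteSite)) ℂ) *ᵥ plaquetteStates U 1 =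
        (2 : ℂ) • plaquetteStates U 1 := by
  constructor
  · have h := totalNumber_mulVec_plaquetteStates U 0
    norm_num at h
    exact h
  · have h := totalNumber_mulVec_plaquetteStates U 1
    norm_num at h
    exact h

/-- **The local band gap of one plaquette (defect form).** Under the plaquette data (W3)–(W5), for some `γ > 0`:
`γ (‖v‖² − Re⟨v, P_band v⟩) ≤ Re⟨v, (h − μN) v⟩ − α‖v‖²` for all `v`, where `P_band = |s₀⟩⟨s₀| + |s₁⟩⟨s₁|`,
`μ = (e₀ − e₂)/2`, `α = 2e₂ − e₀`. [cite: TsaiKivelson2006, App. A] -/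
theorem plaquette_bandGap (U : ℝ)
    (hW3 : ∀ n : ℕ, n ≤ 8 → n ≠ 2 → n ≠ 4 →
      (4 - (n : ℝ)) * groundEnergyAt plaquetteGraph 1 U 2 + ((n : ℝ) - 2) * groundEnergyAt plaquetteGraph 1 U 4 <
        2 * groundEnergyAt plaquetteGraph 1 U n)
    (hW4a : ∀ φ₁ φ₂ : Fock (Orb PlaquetteSite), IsGroundStateInSector (plaquetteHamiltonian U) 4 0 φ₁ →
      IsGroundStateInSector (plaquetteHamiltonian U) 4 0 φ₂ → ∃ a : ℂ, φ₂ = a • φ₁)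
    (hW4b : ∀ φ₁ φ₂ : Fock (Orb PlaquetteSite), IsGroundStateInSector (plaquetteHamiltonian U) 2 0 φ₁ →
      IsGroundStateInSector (plaquetteHamiltonian U) 2 0 φ₂ → ∃ a : ℂ, φ₂ = a • φ₁)
    (hW5a : ∀ m : ℝ, m = 1 ∨ m = -1 ∨ m = 2 ∨ m = -2 →
      (plaquetteHamiltonian U).minEnergyOn (szSector 4 0) < (plaquetteHamiltonian U).minEnergyOn (szSector 4 m))
    (hW5b : ∀ m : ℝ, m = 1 ∨ m = -1 →
      (plaquetteHamiltonian U).minEnergyOn (szSector 2 0) < (plaquetteHamiltonian U).minEnergyOn (szSector 2 m)) :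
    ∃ γ : ℝ, 0 < γ ∧ ∀ v : Fock (Orb PlaquetteSite),
      γ * ((star v ⬝ᵥ v).re - (star v ⬝ᵥ ((vecMulVec (plaquetteStates U 0) (star (plaquetteStates U 0)) +
          vecMulVec (plaquetteStates U 1) (star (plaquetteStates U 1))) *ᵥ v)).re) ≤
        (star v ⬝ᵥ ((plaquetteHamiltonian U -
            (((plaquetteEnergy U 0 - plaquetteEnergy U 2) / 2 : ℝ) : ℂ) • totalNumber) *ᵥ v)).re -
          (2 * plaquetteEnergy U 2 - plaquetteEnergy U 0) * (star v ⬝ᵥ v).re := by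
  set h := plaquetteHamiltonian U with hh
  set s : Fin 2 → Fock (Orb PlaquetteSite) := plaquetteStates U with hs
  set e₀ := plaquetteEnergy U 0 with he₀
  set e₂ := plaquetteEnergy U 2 with he₂
  set μ : ℝ := (e₀ - e₂) / 2 with hμ
  set α : ℝ := 2 * e₂ - e₀ with hα
  set Q : Matrix (Finset (Orb PlaquetteSite)) (Finset (Orb PlaquetteSite)) ℂ := h - (μ : ℂ) • totalNumber with hQ
  have hA : h.IsHermitian := plaquetteHamiltonian_isHermitian U
  have hQh : Q.IsHermitian := by
    rw [hQ]
    exact hA.sub ((totalNumber_isHermitian (Λ := PlaquetteSite)).smul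
      (by rw [isSelfAdjoint_iff, Complex.star_def, Complex.conj_ofReal]))
  have hPS : PreservesSectors h := LiebThm1.preservesSectors_hamiltonian plaquetteGraph 1 U
  have hPSQ : PreservesSectors Q := by
    have hN : PreservesSectors (totalNumber : Matrix (Finset (Orb PlaquetteSite)) (Finset (Orb PlaquetteSite)) ℂ) := by
      rw [LiebThm1.totalNumber_eq_diagonal]
      exact PreservesSectors.diagonal _
    have heq : Q = h + (-(μ : ℂ)) • totalNumber := by rw [hQ, neg_smul, sub_eq_add_neg]
    rw [heq]
    exact hPS.add (hN.smul _)
  have hnn : ∀ u : Fock (Orb PlaquetteSite), 0 ≤ (star u ⬝ᵥ u).re :=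
    fun u => (Complex.nonneg_iff.1 (dotProduct_star_self_nonneg u)).1
  -- the band: eigen-data
  obtain ⟨hh0, hh1⟩ := plaquetteHamiltonian_mulVec_plaquetteStates₀₁ U
  obtain ⟨hN0, hN1⟩ := totalNumber_mulVec_plaquetteStates₀₁ U
  have hQ0 : Q *ᵥ s 0 = (α : ℂ) • s 0 := by
    rw [hQ, sub_mulVec, smul_mulVec, hs, hh0, hN0, smul_smul, ← sub_smul, hα, hμ]
    congr 1
    push_cast
    ring
  have hQ1 : Q *ᵥ s 1 = (α : ℂ) • s 1 := by
    rw [hQ, sub_mulVec, smul_mulVec, hs, hh1, hN1, smul_smul, ← sub_smul, hα, hμ]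
    congr 1
    push_cast
    ring
  have hsec0 : IsInSector 2 2 (s 0) := isInSector_plaquetteStates U 0
  have hsec1 : IsInSector 1 1 (s 1) := isInSector_plaquetteStates U 1
  -- the gaps
  obtain ⟨γ₄, hγ₄, hgap₄⟩ := plaquette_inBand_gap_four U hW4a
  obtain ⟨γ₂, hγ₂, hgap₂⟩ := plaquette_inBand_gap_two U hW4b
  have hoff : ∀ ab : ℕ × ℕ, ∃ δ : ℝ, 0 < δ ∧ (ab.1 ≤ 4 → ab.2 ≤ 4 → ab ≠ (2, 2) → ab ≠ (1, 1) →
      ∀ u : Fock (Orb PlaquetteSite), IsInSector ab.1 ab.2 u →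
        (α + μ * ((ab.1 + ab.2 : ℕ) : ℝ) + δ) * (star u ⬝ᵥ u).re ≤ (star u ⬝ᵥ h *ᵥ u).re) := by
    intro ab
    by_cases hc : ab.1 ≤ 4 ∧ ab.2 ≤ 4 ∧ ab ≠ (2, 2) ∧ ab ≠ (1, 1)
    · obtain ⟨δ, hδ, hb⟩ := plaquette_offBand_gap U hW3 hW5a hW5b hc.1 hc.2.1 hc.2.2.1 hc.2.2.2
      exact ⟨δ, hδ, fun _ _ _ _ u hu => hb u hu⟩
    · refine ⟨1, one_pos, fun h1 h2 h3 h4 => absurd ⟨h1, h2, h3, h4⟩ hc⟩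
  choose δf hδpos hδ using hoff
  set R := Finset.range 5 ×ˢ Finset.range 5 with hR
  have hRne : R.Nonempty := ⟨(0, 0), by simp [hR]⟩
  set γ : ℝ := min γ₄ (min γ₂ (R.inf' hRne δf)) with hγ
  have hγpos : 0 < γ := by
    refine lt_min hγ₄ (lt_min hγ₂ ?_)
    rw [Finset.lt_inf'_iff]
    exact fun ab _ => hδpos ab
  have hγ₄le : γ ≤ γ₄ := min_le_left _ _
  have hγ₂le : γ ≤ γ₂ := le_trans (min_le_right _ _) (min_le_left _ _)
  have hγδ : ∀ ab ∈ R, γ ≤ δf ab := fun ab hab =>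
    le_trans (min_le_right _ _) (le_trans (min_le_right _ _) (Finset.inf'_le _ hab))
  -- the band subspace and its frame
  set W : Submodule ℂ (Fock (Orb PlaquetteSite)) := Submodule.span ℂ {s 0, s 1} with hW
  have hWQ : ∀ w ∈ W, Q *ᵥ w = (α : ℂ) • w := by
    intro w hw
    obtain ⟨a, b, rfl⟩ := Submodule.mem_span_pair.1 hw
    rw [mulVec_add, mulVec_smul, mulVec_smul, hQ0, hQ1, smul_comm a, smul_comm b, ← smul_add]
  set B : Matrix (Finset (Orb PlaquetteSite)) (Fin 2) ℂ := Matrix.of fun x j => s j x with hB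
  have hBcol : ∀ j, (fun x => B x j) = s j := fun j => rfl
  have hBB : B * Bᴴ = vecMulVec (s 0) (star (s 0)) + vecMulVec (s 1) (star (s 1)) := by
    rw [frame_proj_eq_sum_vecMulVec, Fin.sum_univ_two, hBcol, hBcol]
  have hcol : ∀ j, (fun x => B x j) ∈ W := by
    intro j
    rw [hBcol]
    refine Submodule.subset_span ?_
    fin_cases j
    · exact Set.mem_insert _ _
    · exact Set.mem_insert_of_mem _ (Set.mem_singleton _)
  have hfix : ∀ w ∈ W, (B * Bᴴ) *ᵥ w = w := by
    intro w hw
    obtain ⟨a, b, rfl⟩ := Submodule.mem_span_pair.1 hw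
    rw [hBB, add_mulVec, mulVec_add, mulVec_add, mulVec_smul, mulVec_smul, mulVec_smul, mulVec_smul, hs,
      vecMulVec_plaquetteStates_mulVec, vecMulVec_plaquetteStates_mulVec, vecMulVec_plaquetteStates_mulVec,
      vecMulVec_plaquetteStates_mulVec]
    simp
  -- the gap on `W^⊥`
  have hgap : ∀ v, (∀ w ∈ W, star w ⬝ᵥ v = 0) → (α + γ) * (star v ⬝ᵥ v).re ≤ (star v ⬝ᵥ (Q *ᵥ v)).re := by
    intro v hv
    have hv0 : star (s 0) ⬝ᵥ v = 0 := hv _ (Submodule.subset_span (Set.mem_insert _ _))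
    have hv1 : star (s 1) ⬝ᵥ v = 0 := hv _ (Submodule.subset_span (Set.mem_insert_of_mem _ (Set.mem_singleton _)))
    rw [form_eq_sum_sectorProj hPSQ v, normSq_eq_sum_sectorProj v, Complex.re_sum, Complex.re_sum, Finset.mul_sum]
    have hcard : Fintype.card PlaquetteSite + 1 = 5 := by rw [card_plaquetteSite]
    rw [hcard]
    refine Finset.sum_le_sum fun ab hab => ?_
    set u := sectorProj ab.1 ab.2 v with hu
    have huS : IsInSector ab.1 ab.2 u := isInSector_sectorProj _ _ v
    have hNu : totalNumber *ᵥ u = ((ab.1 + ab.2 : ℕ) : ℂ) • u := totalNumber_mulVec_of_isInSector huS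
    have hform : (star u ⬝ᵥ (Q *ᵥ u)).re = (star u ⬝ᵥ (h *ᵥ u)).re - μ * ((ab.1 + ab.2 : ℕ) : ℝ) * (star u ⬝ᵥ u).re := by
      rw [hQ, sub_mulVec, smul_mulVec, hNu, smul_smul, dotProduct_sub, dotProduct_smul, smul_eq_mul, Complex.sub_re,
        ThermodynamicLimit.star_dotProduct_self_eq_re u]
      simp only [Complex.mul_re, Complex.ofReal_re, Complex.ofReal_im, Complex.natCast_re, Complex.natCast_im,
        mul_zero, sub_zero]
    rw [hform]
    have hab' : ab.1 ≤ 4 ∧ ab.2 ≤ 4 := by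
      rw [Finset.mem_product, Finset.mem_range, Finset.mem_range] at hab
      omega
    have huu := hnn u
    by_cases h22 : ab = (2, 2)
    · -- the no-hole band sector
      have hab1 : ab.1 = 2 := by rw [h22]
      have hab2 : ab.2 = 2 := by rw [h22]
      rw [hab1, hab2] at huS
      have hperp : star (plaquetteStates U 0) ⬝ᵥ u = 0 := by
        rw [hu, hab1, hab2, Summit.HubbardSuperconductivity.ColourTheSpin.SgEndpoint.star_dotProduct_sectorProj,
          sectorProj_eq_self hsec0, hv0]
      have hg := hgap₄ u huS hperp
      rw [hab1, hab2]
      push_cast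
      have : γ * (star u ⬝ᵥ u).re ≤ γ₄ * (star u ⬝ᵥ u).re := mul_le_mul_of_nonneg_right hγ₄le huu
      rw [hα, hμ]
      nlinarith
    · by_cases h11 : ab = (1, 1)
      · -- the hole-pair band sector
        have hab1 : ab.1 = 1 := by rw [h11]
        have hab2 : ab.2 = 1 := by rw [h11]
        rw [hab1, hab2] at huS
        have hperp : star (plaquetteStates U 1) ⬝ᵥ u = 0 := by
          rw [hu, hab1, hab2, Summit.HubbardSuperconductivity.ColourTheSpin.SgEndpoint.star_dotProduct_sectorProj,
            sectorProj_eq_self hsec1, hv1]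
        have hg := hgap₂ u huS hperp
        rw [hab1, hab2]
        push_cast
        have : γ * (star u ⬝ᵥ u).re ≤ γ₂ * (star u ⬝ᵥ u).re := mul_le_mul_of_nonneg_right hγ₂le huu
        rw [hα, hμ]
        nlinarith
      · -- off the band
        have hg := hδ ab hab'.1 hab'.2 h22 h11 u huS
        have : γ * (star u ⬝ᵥ u).re ≤ δf ab * (star u ⬝ᵥ u).re := mul_le_mul_of_nonneg_right (hγδ ab hab) huu
        nlinarith
  -- conclude by the defect form of a gapped subspace
  refine ⟨γ, hγpos, fun v => ?_⟩
  have key := re_form_defect_le_of_gap hQh W hWQ hgap hcol hfix v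
  rw [hBB] at key
  exact key

/-! ### Registered form -/

/-- **Registered sub-goal `dressHalfFilled_plaquetteBandGap`** (closed form, as registered on the crux item
stmt-HubbardSuperconductivity-8148): the plaquette data (W3)–(W5) give the local band gap of one plaquette in defect
form, `h − μN − α ≥ γ(1 − P_band)` for some `γ > 0`. [cite: TsaiKivelson2006, App. A] -/
theorem dressHalfFilled_plaquetteBandGap : ∀ (U : ℝ), (∀ n : ℕ, n ≤ 8 → n ≠ 2 → n ≠ 4 → (4 - (n : ℝ)) * groundEnergyAt plaquetteGraph 1 U 2 + ((n : ℝ) - 2) * groundEnergyAt plaquetteGraph 1 U 4 < 2 * groundEnergyAt plaquetteGraph 1 U n) → (∀ φ₁ φ₂ : Fock (Orb PlaquetteSite), IsGroundStateInSector (plaquetteHamiltonian U) 4 0 φ₁ → IsGroundStateInSector (plaquetteHamiltonian U) 4 0 φ₂ → ∃ a : ℂ, φ₂ = a • φ₁) → (∀ φ₁ φ₂ : Fock (Orb PlaquetteSite), IsGroundStateInSector (plaquetteHamiltonian U) 2 0 φ₁ → IsGroundStateInSector (plaquetteHamiltonian U) 2 0 φ₂ → ∃ a : ℂ, φ₂ =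 a • φ₁) → (∀ m : ℝ, m = 1 ∨ m = -1 ∨ m = 2 ∨ m = -2 → (plaquetteHamiltonian U).minEnergyOn (szSector 4 0) < (plaquetteHamiltonian U).minEnergyOn (szSector 4 m)) → (∀ m : ℝ, m = 1 ∨ m = -1 → (plaquetteHamiltonian U).minEnergyOn (szSector 2 0) < (plaquetteHamiltonian U).minEnergyOn (szSector 2 m)) → ∃ γ : ℝ, 0 < γ ∧ ∀ v : Fock (Orb PlaquetteSite), γ * ((star v ⬝ᵥ v).re - (star v ⬝ᵥ ((vecMulVec (plaquetteStates U 0) (star (plaquetteStates U 0)) + vecMulVec (plaquetteStates U 1) (star (plaquetteStates U 1))) *ᵥ v)).re) ≤ (star v ⬝ᵥ ((plaquetteHamiltonian U - (((plaquetteEnergy U 0 - plaquetteEnergy U 2) / 2 : ℝ) : ℂ) • totalNumber) *ᵥ v)).re - (2 * plaquetteEnergy U 2 - plaquetteEnergy U 0) * (star v ⬝ᵥ v).re :=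
  fun U hW3 hW4a hW4b hW5a hW5b => plaquette_bandGap U hW3 hW4a hW4b hW5a hW5b

end Summit.HubbardSuperconductivity.HubbardSuperconductivity.Theorems.LevyLogBootstrap

end
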